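import Literature.Topology.PlaneTopology.BandCrossing
import Mathlib.Analysis.Complex.ReImTopology
import Mathlib.MeasureTheory.MeasurableSpace.Basic
import HarnessLib

/-!
# Continuum crossing events of a random closed planar set are measurable

Topic: Probability / Percolation.  A measurability lemma for continuum percolation models whose
occupied set `K a ⊆ ℂ` is a CLOSED set depending on a random parameter `a` (for Poisson–Voronoi
percolation: the black region of the nuclei): if the hitting events `{a | K a ∩ Q ≠ ∅}` of compact
sets `Q` are measurable, then so is the **continuum crossing event**
"`K a ∩ R` contains a compact connected set meeting both `A` and `A'`" for compact `R` and closed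
`A, A'` (Schramm–Smirnov's notion of crossing, *On the scaling limits of planar percolation*
(2011), §1.3; the event glued by FKG in every RSW argument).

Proof (`measurableSet_exists_continuum`): the event equals `⋂ₙ Dₙ`, where `Dₙ` says that the
closed dyadic squares of side `2⁻ⁿ` meeting `K a ∩ R` contain a chain of pairwise adjacent squares
from one meeting `K a ∩ R ∩ A` to one meeting `K a ∩ R ∩ A'` — a countable union of finite
intersections of hitting events.  A continuum gives chains at every level (the squares meeting a
connected set form a connected family); conversely, if no continuum inside the compact set
`Z = K a ∩ R` meets both `A` and `A'`, the cut-wire theorem (`exists_closed_separation`) splits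
`Z = Z₁ ⊔ Z₂` into closed pieces off `A'` and off `A`, at positive distance `δ`, and a chain of
squares of diameter `< δ/2` cannot lead from `Z ∩ A ⊆ Z₁` to `Z ∩ A' ⊆ Z₂`.

## References
* O. Schramm, S. Smirnov, Ann. Probab. 39 (2011), §1.3. [SchrammSmirnov2011]
* K. Kuratowski, *Topology* II (1968), §47.II Thm 3 (cut-wire theorem).
-/

noncomputable section

namespace Literature.Probability.Percolation

open _root_.Set _root_.Metric Complex
open Literature.Topology.PlaneTopology

/-! ### Dyadic squares -/

/-- The closed dyadic square of level `n` with lower-left corner `q / 2ⁿ`. [folklore] -/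
def dyadicSquare (n : ℕ) (q : ℤ × ℤ) : Set ℂ :=
  (Icc ((q.1 : ℝ) / 2 ^ n) (((q.1 : ℝ) + 1) / 2 ^ n)) ×ℂ (Icc ((q.2 : ℝ) / 2 ^ n) (((q.2 : ℝ) + 1) / 2 ^ n))

/-- Dyadic squares are compact. [folklore] -/
theorem isCompact_dyadicSquare (n : ℕ) (q : ℤ × ℤ) : IsCompact (dyadicSquare n q) :=
  (isCompact_Icc.reProdIm isCompact_Icc)

/-- Membership in a dyadic square, in coordinates. [folklore] -/
theorem mem_dyadicSquare {n : ℕ} {q : ℤ × ℤ} {z : ℂ} :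
    z ∈ dyadicSquare n q ↔ ((q.1 : ℝ) / 2 ^ n ≤ z.re ∧ z.re ≤ ((q.1 : ℝ) + 1) / 2 ^ n) ∧
      ((q.2 : ℝ) / 2 ^ n ≤ z.im ∧ z.im ≤ ((q.2 : ℝ) + 1) / 2 ^ n) := by
  simp [dyadicSquare, mem_reProdIm]

/-- Every point lies in the dyadic square indexed by the floors of its scaled coordinates.
[folklore] -/
theorem mem_dyadicSquare_floor (n : ℕ) (z : ℂ) :
    z ∈ dyadicSquare n (⌊z.re * 2 ^ n⌋, ⌊z.im * 2 ^ n⌋) := by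
  have h2 : (0 : ℝ) < 2 ^ n := by positivity
  rw [mem_dyadicSquare]
  refine ⟨⟨?_, ?_⟩, ?_, ?_⟩
  · rw [div_le_iff₀ h2]; exact Int.floor_le _
  · rw [le_div_iff₀ h2]; exact (Int.lt_floor_add_one _).le
  · rw [div_le_iff₀ h2]; exact Int.floor_le _
  · rw [le_div_iff₀ h2]; exact (Int.lt_floor_add_one _).le

/-- Two dyadic squares of the same level sharing a point have indices differing by at most `1`.
[folklore] -/
theorem sub_le_one_of_mem_dyadicSquare {n : ℕ} {q q' : ℤ × ℤ} {z : ℂ} (hz : z ∈ dyadicSquare n q)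
    (hz' : z ∈ dyadicSquare n q') : |q.1 - q'.1| ≤ 1 ∧ |q.2 - q'.2| ≤ 1 := by
  have h2 : (0 : ℝ) < 2 ^ n := by positivity
  rw [mem_dyadicSquare] at hz hz'
  obtain ⟨⟨h1, h2'⟩, h3, h4⟩ := hz
  obtain ⟨⟨h1', h2''⟩, h3', h4'⟩ := hz'
  rw [div_le_iff₀ h2] at h1 h3 h1' h3'
  rw [le_div_iff₀ h2] at h2' h4 h2'' h4'
  have e1 : ((q.1 : ℝ)) ≤ (q'.1 : ℝ) + 1 := by linarith
  have e2 : ((q'.1 : ℝ)) ≤ (q.1 : ℝ) + 1 := by linarith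
  have e3 : ((q.2 : ℝ)) ≤ (q'.2 : ℝ) + 1 := by linarith
  have e4 : ((q'.2 : ℝ)) ≤ (q.2 : ℝ) + 1 := by linarith
  have f1 : q.1 ≤ q'.1 + 1 := by exact_mod_cast e1
  have f2 : q'.1 ≤ q.1 + 1 := by exact_mod_cast e2
  have f3 : q.2 ≤ q'.2 + 1 := by exact_mod_cast e3
  have f4 : q'.2 ≤ q.2 + 1 := by exact_mod_cast e4
  constructor <;> rw [abs_le] <;> constructor <;> linarith

/-- Points of two dyadic squares with adjacent indices are within `3 / 2ⁿ` of each other.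
[folklore] -/
theorem dist_lt_of_mem_dyadicSquare {n : ℕ} {q q' : ℤ × ℤ} (hq : |q.1 - q'.1| ≤ 1 ∧ |q.2 - q'.2| ≤ 1)
    {z z' : ℂ} (hz : z ∈ dyadicSquare n q) (hz' : z' ∈ dyadicSquare n q') : dist z z' < 3 / 2 ^ n := by
  have h2 : (0 : ℝ) < 2 ^ n := by positivity
  rw [mem_dyadicSquare] at hz hz'
  obtain ⟨⟨h1, h2'⟩, h3, h4⟩ := hz
  obtain ⟨⟨h1', h2''⟩, h3', h4'⟩ := hz'
  rw [div_le_iff₀ h2] at h1 h3 h1' h3'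
  rw [le_div_iff₀ h2] at h2' h4 h2'' h4'
  obtain ⟨ha, hb⟩ := hq
  rw [abs_le] at ha hb
  have ha1 : (q.1 : ℝ) - q'.1 ≤ 1 := by exact_mod_cast ha.2
  have ha2 : -1 ≤ (q.1 : ℝ) - q'.1 := by exact_mod_cast ha.1
  have hb1 : (q.2 : ℝ) - q'.2 ≤ 1 := by exact_mod_cast hb.2
  have hb2 : -1 ≤ (q.2 : ℝ) - q'.2 := by exact_mod_cast hb.1
  have hre : |z.re - z'.re| * 2 ^ n ≤ 2 := by
    rw [← abs_of_pos h2, ← abs_mul, abs_le]; constructor <;> nlinarith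
  have him : |z.im - z'.im| * 2 ^ n ≤ 2 := by
    rw [← abs_of_pos h2, ← abs_mul, abs_le]; constructor <;> nlinarith
  have hsq : ((z.re - z'.re) ^ 2 + (z.im - z'.im) ^ 2) * (2 ^ n) ^ 2 < 3 ^ 2 := by
    have e1 : (|z.re - z'.re| * 2 ^ n) ^ 2 ≤ 2 ^ 2 := by
      exact pow_le_pow_left₀ (by positivity) hre 2
    have e2 : (|z.im - z'.im| * 2 ^ n) ^ 2 ≤ 2 ^ 2 := by
      exact pow_le_pow_left₀ (by positivity) him 2
    rw [mul_pow, sq_abs] at e1 e2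
    nlinarith
  rw [Complex.dist_eq_re_im, Real.sqrt_lt' (by positivity), div_pow, lt_div_iff₀ (by positivity)]
  exact hsq

/-- Only finitely many dyadic squares of a given level meet a bounded set. [folklore] -/
theorem finite_setOf_dyadicSquare_inter_nonempty (n : ℕ) {S : Set ℂ} (hS : Bornology.IsBounded S) :
    {q : ℤ × ℤ | (dyadicSquare n q ∩ S).Nonempty}.Finite := by
  obtain ⟨M, hM⟩ := hS.subset_closedBall 0
  have h2 : (0 : ℝ) < 2 ^ n := by positivity
  set N : ℤ := ⌈M * 2 ^ n⌉ + 1 with hN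
  refine ((Set.finite_Icc (-N) N).prod (Set.finite_Icc (-N) N)).subset ?_
  rintro q ⟨z, hzq, hzS⟩
  have hz := hM hzS
  rw [mem_closedBall, dist_zero_right] at hz
  have hre : |z.re| ≤ M := (abs_re_le_norm z).trans hz
  have him : |z.im| ≤ M := (abs_im_le_norm z).trans hz
  rw [abs_le] at hre him
  rw [mem_dyadicSquare] at hzq
  obtain ⟨⟨h1, h2'⟩, h3, h4⟩ := hzq
  rw [div_le_iff₀ h2] at h1 h3
  rw [le_div_iff₀ h2] at h2' h4
  have hc := Int.le_ceil (M * 2 ^ n)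
  have k1 : (q.1 : ℝ) ≤ M * 2 ^ n := by nlinarith
  have k2 : -(M * 2 ^ n) - 1 ≤ (q.1 : ℝ) := by nlinarith
  have k3 : (q.2 : ℝ) ≤ M * 2 ^ n := by nlinarith
  have k4 : -(M * 2 ^ n) - 1 ≤ (q.2 : ℝ) := by nlinarith
  refine ⟨⟨?_, ?_⟩, ?_, ?_⟩
  · have : (-(N : ℝ)) ≤ q.1 := by rw [hN]; push_cast; linarith
    exact_mod_cast this
  · have : (q.1 : ℝ) ≤ N := by rw [hN]; push_cast; linarith
    exact_mod_cast this
  · have : (-(N : ℝ)) ≤ q.2 := by rw [hN]; push_cast; linarith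
    exact_mod_cast this
  · have : (q.2 : ℝ) ≤ N := by rw [hN]; push_cast; linarith
    exact_mod_cast this

/-! ### Chains of squares -/

section Chains

variable {α : Type*}

/-- Adjacency of dyadic indices: sup-distance at most `1`. [folklore] -/
def DyAdj (q q' : ℤ × ℤ) : Prop := |q.1 - q'.1| ≤ 1 ∧ |q.2 - q'.2| ≤ 1

/-- `k`-step chains for a relation (an explicit, measurability-friendly form of the reflexive
transitive closure). [folklore] -/
def ChainRel (r : ℤ × ℤ → ℤ × ℤ → Prop) : ℕ → ℤ × ℤ → ℤ × ℤ → Prop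
  | 0, q, q' => q = q'
  | k + 1, q, q' => ∃ q'', ChainRel r k q q'' ∧ r q'' q'

/-- The reflexive transitive closure is the union of the `k`-step chains. [folklore] -/
theorem reflTransGen_iff_exists_chainRel (r : ℤ × ℤ → ℤ × ℤ → Prop) (q q' : ℤ × ℤ) :
    Relation.ReflTransGen r q q' ↔ ∃ k, ChainRel r k q q' := by
  constructor
  · intro h
    induction h with
    | refl => exact ⟨0, rfl⟩
    | tail _ hbc ih =>
      obtain ⟨k, hk⟩ := ih
      exact ⟨k + 1, _, hk, hbc⟩
  · rintro ⟨k, hk⟩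
    induction k generalizing q' with
    | zero => cases hk; exact Relation.ReflTransGen.refl
    | succ k ih =>
      obtain ⟨q'', h1, h2⟩ := hk
      exact (ih _ h1).tail h2

variable [MeasurableSpace α]

/-- Chains of a pointwise measurable family of relations are measurable events. [folklore] -/
theorem measurableSet_chainRel {r : α → ℤ × ℤ → ℤ × ℤ → Prop}
    (hr : ∀ q q', MeasurableSet {a | r a q q'}) (k : ℕ) (q q' : ℤ × ℤ) :
    MeasurableSet {a | ChainRel (r a) k q q'} := by
  induction k generalizing q' with
  | zero => exact MeasurableSet.const _
  | succ k ih =>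
    have : {a | ChainRel (r a) (k + 1) q q'} = ⋃ q'', ({a | ChainRel (r a) k q q''} ∩ {a | r a q'' q'}) := by
      ext a; simp [ChainRel]
    rw [this]
    exact MeasurableSet.iUnion fun q'' => (ih q'').inter (hr q'' q')

/-- Reflexive transitive closures of a pointwise measurable family of relations are measurable
events. [folklore] -/
theorem measurableSet_reflTransGen {r : α → ℤ × ℤ → ℤ × ℤ → Prop}
    (hr : ∀ q q', MeasurableSet {a | r a q q'}) (q q' : ℤ × ℤ) :
    MeasurableSet {a | Relation.ReflTransGen (r a) q q'} := by
  have : {a | Relation.ReflTransGen (r a) q q'} = ⋃ k, {a | ChainRel (r a) k q q'} := by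
    ext a; simp [reflTransGen_iff_exists_chainRel]
  rw [this]
  exact MeasurableSet.iUnion fun k => measurableSet_chainRel hr k q q'

end Chains

/-! ### The measurability theorem -/

section Main

variable {α : Type*} [MeasurableSpace α]

/-- The level-`n` **grid-chain event**: the dyadic squares meeting `K a ∩ R` contain a chain of
pairwise adjacent squares from one meeting `K a ∩ R ∩ A` to one meeting `K a ∩ R ∩ A'`.
[folklore] -/
def gridChainEvent (K : α → Set ℂ) (R A A' : Set ℂ) (n : ℕ) : Set α :=
  {a | ∃ q q' : ℤ × ℤ, (K a ∩ R ∩ A ∩ dyadicSquare n q).Nonempty ∧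
    (K a ∩ R ∩ A' ∩ dyadicSquare n q').Nonempty ∧
    Relation.ReflTransGen (fun p p' => DyAdj p p' ∧ (K a ∩ R ∩ dyadicSquare n p).Nonempty ∧
      (K a ∩ R ∩ dyadicSquare n p').Nonempty) q q'}

/-- Grid-chain events are measurable when the hitting events of compact sets are. [folklore] -/
theorem measurableSet_gridChainEvent {K : α → Set ℂ}
    (hmeas : ∀ Q : Set ℂ, IsCompact Q → MeasurableSet {a | (K a ∩ Q).Nonempty}) {R A A' : Set ℂ}
    (hR : IsCompact R) (hA : IsClosed A) (hA' : IsClosed A') (n : ℕ) :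
    MeasurableSet (gridChainEvent K R A A' n) := by
  have hhit : ∀ (S : Set ℂ), IsClosed S → ∀ q, MeasurableSet {a | (K a ∩ R ∩ S ∩ dyadicSquare n q).Nonempty} := by
    intro S hS q
    have : ∀ a, K a ∩ R ∩ S ∩ dyadicSquare n q = K a ∩ (R ∩ S ∩ dyadicSquare n q) := fun a => by
      simp only [inter_assoc]
    simp_rw [this]
    exact hmeas _ ((hR.inter_right hS).inter_right (isCompact_dyadicSquare n q).isClosed)
  have hhit' : ∀ q, MeasurableSet {a | (K a ∩ R ∩ dyadicSquare n q).Nonempty} := by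
    intro q
    have := hhit univ isClosed_univ q
    simpa only [inter_univ] using this
  have : gridChainEvent K R A A' n = ⋃ q, ⋃ q', ({a | (K a ∩ R ∩ A ∩ dyadicSquare n q).Nonempty} ∩
      {a | (K a ∩ R ∩ A' ∩ dyadicSquare n q').Nonempty} ∩
      {a | Relation.ReflTransGen (fun p p' => DyAdj p p' ∧ (K a ∩ R ∩ dyadicSquare n p).Nonempty ∧
        (K a ∩ R ∩ dyadicSquare n p').Nonempty) q q'}) := by
    ext a; simp only [gridChainEvent, mem_setOf_eq, mem_iUnion, mem_inter_iff]; tauto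
  rw [this]
  refine MeasurableSet.iUnion fun q => MeasurableSet.iUnion fun q' =>
    ((hhit A hA q).inter (hhit A' hA' q')).inter (measurableSet_reflTransGen (fun p p' => ?_) q q')
  exact (MeasurableSet.const _).inter ((hhit' p).inter (hhit' p'))

omit [MeasurableSpace α] in
/-- A continuum yields grid chains at every level (the squares meeting a connected set form a
connected family for adjacency). [folklore] -/
theorem mem_gridChainEvent_of_continuum {K : α → Set ℂ} {R A A' : Set ℂ} {a : α} {C : Set ℂ}
    (hCK : C ⊆ K a ∩ R) (hC : IsCompact C) (hCc : IsPreconnected C) (hCA : (C ∩ A).Nonempty)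
    (hCA' : (C ∩ A').Nonempty) (n : ℕ) : a ∈ gridChainEvent K R A A' n := by
  classical
  obtain ⟨x, hxC, hxA⟩ := hCA
  obtain ⟨y, hyC, hyA'⟩ := hCA'
  set qx : ℤ × ℤ := (⌊x.re * 2 ^ n⌋, ⌊x.im * 2 ^ n⌋)
  set qy : ℤ × ℤ := (⌊y.re * 2 ^ n⌋, ⌊y.im * 2 ^ n⌋)
  have hxq : x ∈ dyadicSquare n qx := mem_dyadicSquare_floor n x
  have hyq : y ∈ dyadicSquare n qy := mem_dyadicSquare_floor n y
  set r : ℤ × ℤ → ℤ × ℤ → Prop := fun p p' => DyAdj p p' ∧ (K a ∩ R ∩ dyadicSquare n p).Nonempty ∧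
    (K a ∩ R ∩ dyadicSquare n p').Nonempty with hr
  refine ⟨qx, qy, ⟨x, ⟨⟨hCK hxC, hxA⟩, hxq⟩⟩, ⟨y, ⟨⟨hCK hyC, hyA'⟩, hyq⟩⟩, ?_⟩
  -- the squares reachable from `qx` and the others cover `C` by two closed sets
  by_contra hnot
  set S : Set (ℤ × ℤ) := {p | (C ∩ dyadicSquare n p).Nonempty} with hS
  have hSfin : S.Finite := by
    have := finite_setOf_dyadicSquare_inter_nonempty n hC.isBounded
    refine this.subset fun p hp => ?_
    obtain ⟨z, hzC, hzp⟩ := hp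
    exact ⟨z, hzp, hzC⟩
  set S₁ : Set (ℤ × ℤ) := {p ∈ S | Relation.ReflTransGen r qx p} with hS₁
  set S₂ : Set (ℤ × ℤ) := {p ∈ S | ¬ Relation.ReflTransGen r qx p} with hS₂
  set U₁ : Set ℂ := ⋃ p ∈ S₁, dyadicSquare n p with hU₁
  set U₂ : Set ℂ := ⋃ p ∈ S₂, dyadicSquare n p with hU₂
  have hU₁c : IsClosed U₁ := (hSfin.subset (sep_subset _ _)).isClosed_biUnion
    fun p _ => (isCompact_dyadicSquare n p).isClosed
  have hU₂c : IsClosed U₂ := (hSfin.subset (sep_subset _ _)).isClosed_biUnion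
    fun p _ => (isCompact_dyadicSquare n p).isClosed
  have hcover : C ⊆ U₁ ∪ U₂ := by
    intro z hz
    set p : ℤ × ℤ := (⌊z.re * 2 ^ n⌋, ⌊z.im * 2 ^ n⌋)
    have hzp : z ∈ dyadicSquare n p := mem_dyadicSquare_floor n z
    have hpS : p ∈ S := ⟨z, hz, hzp⟩
    by_cases h : Relation.ReflTransGen r qx p
    · exact Or.inl (mem_biUnion (⟨hpS, h⟩ : p ∈ S₁) hzp)
    · exact Or.inr (mem_biUnion (⟨hpS, h⟩ : p ∈ S₂) hzp)
  have hx₁ : (C ∩ U₁).Nonempty := ⟨x, hxC, mem_biUnion (⟨⟨x, hxC, hxq⟩, Relation.ReflTransGen.refl⟩ : qx ∈ S₁) hxq⟩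
  have hy₂ : (C ∩ U₂).Nonempty := ⟨y, hyC, mem_biUnion (⟨⟨y, hyC, hyq⟩, hnot⟩ : qy ∈ S₂) hyq⟩
  obtain ⟨z, hzC, hz₁, hz₂⟩ := isPreconnected_closed_iff.1 hCc U₁ U₂ hU₁c hU₂c hcover hx₁ hy₂
  rw [hU₁, mem_iUnion₂] at hz₁
  rw [hU₂, mem_iUnion₂] at hz₂
  obtain ⟨p₁, hp₁, hzp₁⟩ := hz₁
  obtain ⟨p₂, hp₂, hzp₂⟩ := hz₂
  apply hp₂.2
  refine hp₁.2.tail ⟨sub_le_one_of_mem_dyadicSquare hzp₁ hzp₂, ?_, ?_⟩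
  · obtain ⟨w, hwC, hwp⟩ := hp₁.1; exact ⟨w, hCK hwC, hwp⟩
  · obtain ⟨w, hwC, hwp⟩ := hp₂.1; exact ⟨w, hCK hwC, hwp⟩

/-- **Measurability of continuum crossing events.**  Let `K a ⊆ ℂ` be closed for every `a`, with
measurable hitting events `{a | K a ∩ Q ≠ ∅}` for all compact `Q`.  Then for compact `R` and
closed `A, A'`, the event "some compact connected `C ⊆ K a ∩ R` meets both `A` and `A'`" is
measurable: it is the intersection over `n` of the level-`n` grid-chain events.
[cite: SchrammSmirnov2011, §1.3] -/
theorem measurableSet_exists_continuum {K : α → Set ℂ} (hK : ∀ a, IsClosed (K a))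
    (hmeas : ∀ Q : Set ℂ, IsCompact Q → MeasurableSet {a | (K a ∩ Q).Nonempty}) {R A A' : Set ℂ}
    (hR : IsCompact R) (hA : IsClosed A) (hA' : IsClosed A') :
    MeasurableSet {a | ∃ C ⊆ K a ∩ R, IsCompact C ∧ IsPreconnected C ∧ (C ∩ A).Nonempty ∧
      (C ∩ A').Nonempty} := by
  have key : {a | ∃ C ⊆ K a ∩ R, IsCompact C ∧ IsPreconnected C ∧ (C ∩ A).Nonempty ∧
      (C ∩ A').Nonempty} = ⋂ n, gridChainEvent K R A A' n := by
    ext a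
    simp only [mem_setOf_eq, mem_iInter]
    constructor
    · rintro ⟨C, hCK, hC, hCc, hCA, hCA'⟩ n
      exact mem_gridChainEvent_of_continuum hCK hC hCc hCA hCA' n
    · intro h
      by_contra hno
      simp only [not_exists, not_and] at hno
      -- the compact set `Z = K a ∩ R` and its cut-wire separation
      set Z := K a ∩ R with hZ
      have hZc : IsCompact Z := hR.inter_left (hK a)
      obtain ⟨Z₁, Z₂, hZ₁c, hZ₂c, hZdisj, hZunion, hZ₁A', hZ₂A⟩ :=
        exists_closed_separation hZc hA hA' fun C hCZ hCc hCA hCA' =>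
          hno (closure C) (closure_minimal hCZ hZc.isClosed)
            (hZc.of_isClosed_subset isClosed_closure (closure_minimal hCZ hZc.isClosed))
            hCc.closure (hCA.mono (inter_subset_inter_left _ subset_closure))
            (hCA'.mono (inter_subset_inter_left _ subset_closure))
      have hZ₁Z : Z₁ ⊆ Z := hZunion ▸ subset_union_left
      have hZ₂Z : Z₂ ⊆ Z := hZunion ▸ subset_union_right
      -- a positive distance between the two pieces
      obtain ⟨δ, hδ, hthick⟩ := hZdisj.exists_cthickenings (hZc.of_isClosed_subset hZ₁c hZ₁Z) hZ₂c
      have hfar : ∀ x ∈ Z₁, ∀ y ∈ Z₂, δ < dist x y := by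
        intro x hx y hy
        by_contra hle
        rw [not_lt] at hle
        exact Set.disjoint_left.1 hthick (mem_cthickening_of_dist_le y x δ Z₁ hx (by rwa [dist_comm]))
          (self_subset_cthickening Z₂ hy)
      -- a level `n` with squares of diameter `< δ`
      obtain ⟨n, hn⟩ := exists_nat_gt (3 / δ)
      have h2n : (3 : ℝ) / 2 ^ n < δ := by
        have : (n : ℝ) ≤ 2 ^ n := by exact_mod_cast Nat.lt_two_pow_self.le
        rw [div_lt_iff₀ (by positivity)]
        rw [div_lt_iff₀ hδ] at hn
        nlinarith
      -- the chain at level `n`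
      obtain ⟨q, q', ⟨x₀, ⟨⟨hx₀Z, hx₀A⟩, hx₀q⟩⟩, ⟨y₀, ⟨⟨hy₀Z, hy₀A'⟩, hy₀q'⟩⟩, hchain⟩ := h n
      -- invariant: every square reachable from `q` has its `Z`-part inside `Z₁`
      have hx₀Z₁ : x₀ ∈ Z₁ := by
        have : x₀ ∈ Z₁ ∪ Z₂ := hZunion.symm ▸ hx₀Z
        exact this.resolve_right fun h2 => Set.disjoint_left.1 hZ₂A h2 hx₀A
      have hnear : ∀ {p p' : ℤ × ℤ}, DyAdj p p' → ∀ w ∈ Z₁, w ∈ dyadicSquare n p →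
          ∀ z ∈ Z, z ∈ dyadicSquare n p' → z ∈ Z₁ := by
        intro p p' hpp' w hw hwp z hz hzp
        have hd := dist_lt_of_mem_dyadicSquare hpp' hwp hzp
        have : z ∈ Z₁ ∪ Z₂ := hZunion.symm ▸ hz
        refine this.resolve_right fun hz2 => ?_
        have := hfar w hw z hz2
        linarith
      have hinv : ∀ p, Relation.ReflTransGen (fun p p' => DyAdj p p' ∧
          (K a ∩ R ∩ dyadicSquare n p).Nonempty ∧ (K a ∩ R ∩ dyadicSquare n p').Nonempty) q p →
          ∀ z ∈ Z, z ∈ dyadicSquare n p → z ∈ Z₁ := by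
        intro p hp
        induction hp with
        | refl =>
          intro z hz hzq
          exact hnear ⟨by simp, by simp⟩ x₀ hx₀Z₁ hx₀q z hz hzq
        | tail _ hr ih =>
          obtain ⟨hadj, ⟨w, hwZ, hwp⟩, -⟩ := hr
          intro z hz hzp
          exact hnear hadj w (ih w hwZ hwp) hwp z hz hzp
      have hy₀Z₁ : y₀ ∈ Z₁ := hinv q' hchain y₀ hy₀Z hy₀q'
      exact Set.disjoint_left.1 hZ₁A' hy₀Z₁ hy₀A'
  rw [key]
  exact MeasurableSet.iInter fun n => measurableSet_gridChainEvent hmeas hR hA hA' n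

end Main

end Literature.Probability.Percolation
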